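import Summits.CriticalPhenomena.PercolationContinuityZ3.Theorems.Transplant.PlanarSkeletonFrmScaledRayEsc
import HarnessLib

/-!
# Scaled Φ2 port, XVI′: finite UP-CLOSED regions for the ray kits of a `PlanarSkeletonFrmScaled` — the HULL of a finite set under the two
# `N`-step maps is finite (potential `φ₀ + φ₁`), twin of `PlanarSkeletonFrmRayHull`

builds on p205010 (kernel theorem, internal audit signed; external expert review pending) — nothing in this file uses p205010; nothing here is a
claim about the open node `SamePDropOfSkeletonFrmScaled₁`.  Lane `prim-bschramm`, seat `prim-bschramm-p4` gen 16 (PART C3 of `P4-GENERAL.md` §38.5,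
HOME/prim-bschramm-p4-g16/SCALED-PHI2-PORT.md).  Helper file (`--supports stmt-CriticalPhenomena-4575 --as helper`).  Pure combinatorics.

As in XVI, the regions `Ω n` of the Aizenman–Grimmett setup must be finite, increasing, exhausting and UP-CLOSED (closed under `stpC 0`, `stpC 1` at
inner vertices); here the step maps are those of XV′ on the big cylinder `C_R(t)` (`R ≥ ℓ + N`, hypothesis `hR` carried explicitly):
* `reach`, `hull`, `hull_closed`, `subset_hull`, `hull_mono`, `hull_union` — verbatim;
* `finite_hull`: the potential `φ₀ + φ₁` rises by `N ≥ 1` per step and is `≤ 2ℓ` at inner vertices (`gap`, `gap_stpC_lt`, `finite_reach`).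
[cite: AizenmanGrimmett1991, Thm 1 (essential enhancements)] [cite: GrimmettPercolation1999, §7.2 (the subgraph/region set-up)]
-/

noncomputable section

namespace Summit.CriticalPhenomena.PercolationContinuityZ3.Theorems.Transplant

namespace PlanarSkeletonFrmScaled

open SimpleGraph Walk Literature.Probability.LatticeModels
open scoped Classical

-- the scaled skeleton is called `Ψ` in this file (scaled twins of XVI's statements, over a different structure)
variable {V : Type} {G : SimpleGraph V} [G.LocallyFinite] (Ψ : PlanarSkeletonFrmScaled G)

section Cyl

variable {t : V} {ℓ R : ℕ}

/-! ## §1 Reach and hull -/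

/-- **The step successors** of a vertex of the big cylinder: `stpC 0 z` and `stpC 1 z` if `z` is inner, none otherwise. [folklore] -/
def stepSucc (t : V) (ℓ R : ℕ) (hR : ℓ + Ψ.N ≤ R) (z : Ψ.cyl t R) : Set (Ψ.cyl t R) :=
  {w | Ψ.φ z.1 - Ψ.φ t ∈ box 2 ℓ ∧ (w = Ψ.stpC t ℓ R hR 0 z ∨ w = Ψ.stpC t ℓ R hR 1 z)}

/-- **The reach** of a vertex: everything obtained from it by iterated steps at inner vertices. [folklore] -/
def reach (t : V) (ℓ R : ℕ) (hR : ℓ + Ψ.N ≤ R) (z : Ψ.cyl t R) : Set (Ψ.cyl t R) :=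
  {w | Relation.ReflTransGen (fun a b => b ∈ Ψ.stepSucc t ℓ R hR a) z w}

/-- **The hull** of a set: the union of the reaches of its elements. [folklore] -/
def hull (t : V) (ℓ R : ℕ) (hR : ℓ + Ψ.N ≤ R) (S : Set (Ψ.cyl t R)) : Set (Ψ.cyl t R) := {w | ∃ z ∈ S, w ∈ Ψ.reach t ℓ R hR z}

/-- A vertex lies in its reach. [folklore] -/
theorem mem_reach_self (hR : ℓ + Ψ.N ≤ R) (z : Ψ.cyl t R) : z ∈ Ψ.reach t ℓ R hR z := Relation.ReflTransGen.refl

/-- A set lies in its hull. [folklore] -/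
theorem subset_hull (hR : ℓ + Ψ.N ≤ R) (S : Set (Ψ.cyl t R)) : S ⊆ Ψ.hull t ℓ R hR S := fun z hz => ⟨z, hz, Ψ.mem_reach_self hR z⟩

/-- Hulls are monotone. [folklore] -/
theorem hull_mono (hR : ℓ + Ψ.N ≤ R) {S T : Set (Ψ.cyl t R)} (h : S ⊆ T) : Ψ.hull t ℓ R hR S ⊆ Ψ.hull t ℓ R hR T :=
  fun _ ⟨z, hz, hr⟩ => ⟨z, h hz, hr⟩

/-- **Hulls are up-closed**: closed under both step maps at inner vertices. [folklore] -/
theorem hull_closed (hR : ℓ + Ψ.N ≤ R) (S : Set (Ψ.cyl t R)) :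
    ∀ z ∈ Ψ.hull t ℓ R hR S, Ψ.φ z.1 - Ψ.φ t ∈ box 2 ℓ →
      Ψ.stpC t ℓ R hR 0 z ∈ Ψ.hull t ℓ R hR S ∧ Ψ.stpC t ℓ R hR 1 z ∈ Ψ.hull t ℓ R hR S := by
  rintro z ⟨z₀, hz₀, hr⟩ hin
  exact ⟨⟨z₀, hz₀, Relation.ReflTransGen.tail hr ⟨hin, Or.inl rfl⟩⟩, ⟨z₀, hz₀, Relation.ReflTransGen.tail hr ⟨hin, Or.inr rfl⟩⟩⟩

/-- The hull of a union. [folklore] -/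
theorem hull_union (hR : ℓ + Ψ.N ≤ R) (S T : Set (Ψ.cyl t R)) :
    Ψ.hull t ℓ R hR (S ∪ T) = Ψ.hull t ℓ R hR S ∪ Ψ.hull t ℓ R hR T := by
  ext w
  constructor
  · rintro ⟨z, hz | hz, hr⟩
    · exact Or.inl ⟨z, hz, hr⟩
    · exact Or.inr ⟨z, hz, hr⟩
  · rintro (⟨z, hz, hr⟩ | ⟨z, hz, hr⟩)
    · exact ⟨z, Or.inl hz, hr⟩
    · exact ⟨z, Or.inr hz, hr⟩

/-! ## §2 Finiteness -/

/-- **The potential gap**: `2ℓ + 1 − (φ₀ + φ₁)` (relative to `t`), truncated at `0`; it drops at every step from an inner vertex. [folklore] -/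
def gap (t : V) (ℓ : ℕ) (z : Ψ.cyl t R) : ℕ :=
  ((2 * ℓ : ℤ) + 1 - ((Ψ.φ z.1 0 - Ψ.φ t 0) + (Ψ.φ z.1 1 - Ψ.φ t 1))).toNat

/-- A step raises `φ₀ + φ₁` by `N`. [folklore] -/
theorem sum_φ_stp (i : Fin 2) (v : V) : Ψ.φ (Ψ.stp i v) 0 + Ψ.φ (Ψ.stp i v) 1 = Ψ.φ v 0 + Ψ.φ v 1 + Ψ.N := by
  have hi : i = 0 ∨ i = 1 := by
    rcases i with ⟨i, hi⟩
    have : i = 0 ∨ i = 1 := by omega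
    rcases this with rfl | rfl
    · exact Or.inl rfl
    · exact Or.inr rfl
  rcases hi with rfl | rfl
  · rw [Ψ.φ_stp_same, Ψ.φ_stp_ne (show (1 : Fin 2) ≠ 0 by decide)]; ring
  · rw [Ψ.φ_stp_same, Ψ.φ_stp_ne (show (0 : Fin 2) ≠ 1 by decide)]; ring

/-- A step from an inner vertex lowers the gap. [folklore] -/
theorem gap_stpC_lt (hR : ℓ + Ψ.N ≤ R) {z : Ψ.cyl t R} (hin : Ψ.φ z.1 - Ψ.φ t ∈ box 2 ℓ) (i : Fin 2) :
    Ψ.gap t ℓ (Ψ.stpC t ℓ R hR i z) < Ψ.gap t ℓ z := by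
  have hN1 : 1 ≤ Ψ.N := Ψ.one_le_N
  have h2 := PlanarSkeletonFrm.mem_box_two.1 hin
  simp only [Pi.sub_apply] at h2
  obtain ⟨h0, h1⟩ := h2
  rw [abs_le] at h0 h1
  have hv := Ψ.stpC_val hR i hin
  have hs := Ψ.sum_φ_stp i z.1
  unfold gap
  rw [hv]
  omega

/-- The reach of a vertex decomposes along its first step. [folklore] -/
theorem reach_subset (hR : ℓ + Ψ.N ≤ R) (z : Ψ.cyl t R) :
    Ψ.reach t ℓ R hR z ⊆ {z} ∪ (Ψ.reach t ℓ R hR (Ψ.stpC t ℓ R hR 0 z) ∪ Ψ.reach t ℓ R hR (Ψ.stpC t ℓ R hR 1 z)) := by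
  intro w hw
  rcases Relation.ReflTransGen.cases_head_iff.1 hw with rfl | ⟨c, ⟨-, hc⟩, hcw⟩
  · exact Or.inl rfl
  · rcases hc with rfl | rfl
    · exact Or.inr (Or.inl hcw)
    · exact Or.inr (Or.inr hcw)

/-- A non-inner vertex reaches only itself. [folklore] -/
theorem reach_subset_of_not_inner (hR : ℓ + Ψ.N ≤ R) {z : Ψ.cyl t R} (h : Ψ.φ z.1 - Ψ.φ t ∉ box 2 ℓ) :
    Ψ.reach t ℓ R hR z ⊆ {z} := by
  intro w hw
  rcases Relation.ReflTransGen.cases_head_iff.1 hw with rfl | ⟨c, ⟨hin, -⟩, -⟩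
  · rfl
  · exact absurd hin h

/-- **The reach of a vertex is finite** (induction on the gap). [folklore] -/
theorem finite_reach (hR : ℓ + Ψ.N ≤ R) : ∀ (n : ℕ) (z : Ψ.cyl t R), Ψ.gap t ℓ z ≤ n → (Ψ.reach t ℓ R hR z).Finite := by
  intro n
  induction n with
  | zero =>
    intro z hz
    refine (Set.finite_singleton z).subset (Ψ.reach_subset_of_not_inner hR fun hin => ?_)
    have h2 := PlanarSkeletonFrm.mem_box_two.1 hin
    simp only [Pi.sub_apply] at h2
    obtain ⟨h0, h1⟩ := h2
    rw [abs_le] at h0 h1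
    have : 0 < Ψ.gap t ℓ z := by unfold gap; omega
    omega
  | succ n ih =>
    intro z hz
    by_cases hin : Ψ.φ z.1 - Ψ.φ t ∈ box 2 ℓ
    · refine ((Set.finite_singleton z).union ((ih _ ?_).union (ih _ ?_))).subset (Ψ.reach_subset hR z)
      · have := Ψ.gap_stpC_lt hR hin 0; omega
      · have := Ψ.gap_stpC_lt hR hin 1; omega
    · exact (Set.finite_singleton z).subset (Ψ.reach_subset_of_not_inner hR hin)

/-- **Hulls of finite sets are finite.** [folklore] -/
theorem finite_hull (hR : ℓ + Ψ.N ≤ R) {S : Set (Ψ.cyl t R)} (hS : S.Finite) : (Ψ.hull t ℓ R hR S).Finite := by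
  have : Ψ.hull t ℓ R hR S = ⋃ z ∈ S, Ψ.reach t ℓ R hR z := by
    ext w; simp only [hull, Set.mem_setOf_eq, Set.mem_iUnion, exists_prop]
  rw [this]
  exact hS.biUnion fun z _ => Ψ.finite_reach hR _ z le_rfl

end Cyl

end PlanarSkeletonFrmScaled

end Summit.CriticalPhenomena.PercolationContinuityZ3.Theorems.Transplant

end
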